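import Summits.ResolutionOfSingularities.ResolutionOfSingularities.Theorems.EquisingularLiftEquisingularLiftNatMultisectionAdapter
import Summits.ResolutionOfSingularities.ResolutionOfSingularities.Theorems.EquisingularLiftEquisingularLiftNatStalkDimension
import HarnessLib

/-!
# [OURS · L1 W4.5(b) · EL♮] The (MS) adapter with its dimension input discharged
# (`hMS_of_multisection` ∘ T-DIM; crux `EquisingularLiftNat` = stmt-ResolutionOfSingularities-20038)

HONEST FRAMING. OURS (cell res-hironaka, crux chain w45b, slot W4.5(b)); NOT a statement of any manuscript; AI-written, weaker
than expert review. Helper `--supports stmt-ResolutionOfSingularities-20038 --as helper`.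

res-D-pv-003's adapter `hMS_of_multisection` (p513364, …NatMultisectionAdapter.lean) derives the (MS) device of T-TAIL
(`horizChainE1_of_pointResolvable`, p508794) from T-MULTISEC, taking as a hypothesis the per-stage dimension input
`hdim : dim 𝒪_{X′,x} = n + 1` at closed special-fibre points of the `Ch`-stages. T-DIM (`ringKrullDim_stalk_eq_succ_of_chain`,
p513633, …NatStalkDimension.lean) proves exactly this for every stage of an item chain over an integral `P` smooth OF RELATIVE
DIMENSION `n` over the DVR. This file composes the two:

* `hdim_of_smoothOfRelativeDimension` — the `hdim` binder of the adapter, discharged;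
* `hMS_of_multisection_of_smoothOfRelativeDimension` (and `…_finrank`) — the adapter WITHOUT `hdim`, the smoothness hypothesis
  `Smooth q` being strengthened to `SmoothOfRelativeDimension n q` (for `ℙⁿ_O`:
  `StrataSplit.smoothOfRelativeDimension_toSpecZero_specMap n O`, Theorems/…ProjectiveAmbientSmoothProper.lean).

References: the two cited tree files; Matsumura, *Commutative Ring Theory*, Thms. 8.4, 14.2, 15.6 (through them).
-/

set_option linter.dupNamespace false -- mandated namespace `Summit.<Summit>.<Problem>` of this single-conjunct summit

open CategoryTheory CategoryTheory.Limits AlgebraicGeometry TopologicalSpace Topology IsLocalRing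
open Literature.AlgebraicGeometry.Resolution
open AlgebraicGeometry.Scheme.IdealSheafData
open Summit.ResolutionOfSingularities.ResolutionOfSingularities.Theses.EquisingularLift.Split

namespace Summit.ResolutionOfSingularities.ResolutionOfSingularities.Cruxes.EquisingularLiftNat.Sections

/-- **The dimension input `hdim` of the (MS) adapter, discharged by T-DIM**: for `q : P → Spec O` smooth of relative dimension
`n` over a DVR with `P` integral, `Y ⊆ P` closed irreducible, and any stage predicate `Ch` implying the item chain
`Split.Chain P Y`, every closed point `x` of a `Ch`-stage lying over the closed point of `O` has `dim 𝒪_{X′,x} = n + 1`.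
[cite: Matsumura1987, Thm. 15.6] -/
theorem hdim_of_smoothOfRelativeDimension (O : Type) [CommRing O] [IsDomain O] [IsDiscreteValuationRing O]
    (P : Scheme.{0}) [IsIntegral P] (q : P ⟶ Spec (.of O)) (Y : Closeds P)
    (Ch : ∀ X' : Scheme.{0}, (X' ⟶ P) → Set X' → Prop)
    (hChain : ∀ (X' : Scheme.{0}) (σ : X' ⟶ P) (S : Set X'), Ch X' σ S → Chain P (Y : Set P) X' σ S)
    (hYirr : IsIrreducible (Y : Set P)) (n : ℕ) [SmoothOfRelativeDimension n q] :
    ∀ (X' : Scheme.{0}) (σ' : X' ⟶ P) (S' : Set X'), Ch X' σ' S' → ∀ x : X', IsClosed ({x} : Set X') →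
      (σ' ≫ q) x = IsLocalRing.closedPoint O → ringKrullDim (X'.presheaf.stalk x) = (n + 1 : ℕ) := by
  intro X' σ' S' hCh x hx hxs
  obtain ⟨ξ, hξ⟩ : ∃ ξ : P, IsGenericPoint ξ (Y : Set P) := QuasiSober.sober hYirr Y.isClosed
  exact ringKrullDim_stalk_eq_succ_of_chain q n hξ (hChain X' σ' S' hCh) hx hxs

/-- **THE (MS) ADAPTER WITHOUT THE DIMENSION INPUT** (`hMS_of_multisection` ∘ T-DIM), `μ`-spelling of `Adm`: for `q : P → Spec O`
smooth of relative dimension `n` over a complete DVR with algebraically closed residue field, `P` integral, `Y ⊆ q⁻¹{s₀}` closed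
irreducible and `Ch ⇒ Chain`, the (MS) binder of T-TAIL holds verbatim. [folklore packaging; cite: Matsumura1987, Thm. 8.4 and Thm. 14.2] -/
theorem hMS_of_multisection_of_smoothOfRelativeDimension (O : Type) [CommRing O] [IsDomain O] [IsDiscreteValuationRing O]
    [IsAdicComplete (maximalIdeal O) O] [IsAlgClosed (ResidueField O)]
    (P : Scheme.{0}) [IsIntegral P] (q : P ⟶ Spec (.of O)) (Y : Closeds P)
    (Ch : ∀ X' : Scheme.{0}, (X' ⟶ P) → Set X' → Prop)
    (hChain : ∀ (X' : Scheme.{0}) (σ : X' ⟶ P) (S : Set X'), Ch X' σ S → Chain P (Y : Set P) X' σ S)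
    (hY : (Y : Set P) ⊆ q ⁻¹' {IsLocalRing.closedPoint O}) (hYirr : IsIrreducible (Y : Set P)) (n : ℕ)
    [SmoothOfRelativeDimension n q] :
    ∀ (X' : Scheme.{0}) (σ' : X' ⟶ P) (S' : Set X'), Ch X' σ' S' → IsLocallyNoetherian X' →
      Scheme.IsRegular X' → IsProper (σ' ≫ q) →
      ∀ (z : ↥(vanishingIdeal (⟨closure S', isClosed_closure⟩ : Closeds X')).subscheme),
        IsClosed ({((vanishingIdeal (⟨closure S', isClosed_closure⟩ : Closeds X')).subschemeι z : X')} : Set X') →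
        ¬ IsRegularLocalRing ((vanishingIdeal (⟨closure S', isClosed_closure⟩ : Closeds X')).subscheme.presheaf.stalk z) →
        (maximalIdeal ((vanishingIdeal (⟨closure S', isClosed_closure⟩ : Closeds X')).subscheme.presheaf.stalk z)).spanFinrank
            ≤ n →
        ∃ C : X'.IdealSheafData, Scheme.IsRegular C.subscheme ∧ Flat (C.subschemeι ≫ σ' ≫ q) ∧
          (C.support : Set X') ∩ (σ' ≫ q) ⁻¹' {IsLocalRing.closedPoint O} =
            {((vanishingIdeal (⟨closure S', isClosed_closure⟩ : Closeds X')).subschemeι z : X')} ∧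
          ∃ hzc : IsClosed ({z} : Set ↥(vanishingIdeal (⟨closure S', isClosed_closure⟩ : Closeds X')).subscheme),
            C.comap (vanishingIdeal (⟨closure S', isClosed_closure⟩ : Closeds X')).subschemeι = vanishingIdeal ⟨{z}, hzc⟩ :=
  hMS_of_multisection O P q Y Ch hChain (SmoothOfRelativeDimension.smooth n q) hY hYirr n
    (hdim_of_smoothOfRelativeDimension O P q Y Ch hChain hYirr n)

/-- The same with res-D-pv-013's spelling `Adm Γ x :⟺ dim_κ 𝔪_{Γ,x}/𝔪² ≤ n`. [folklore packaging; cite: Matsumura1987, Thm. 8.4 and Thm. 14.2] -/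
theorem hMS_of_multisection_finrank_of_smoothOfRelativeDimension (O : Type) [CommRing O] [IsDomain O]
    [IsDiscreteValuationRing O] [IsAdicComplete (maximalIdeal O) O] [IsAlgClosed (ResidueField O)]
    (P : Scheme.{0}) [IsIntegral P] (q : P ⟶ Spec (.of O)) (Y : Closeds P)
    (Ch : ∀ X' : Scheme.{0}, (X' ⟶ P) → Set X' → Prop)
    (hChain : ∀ (X' : Scheme.{0}) (σ : X' ⟶ P) (S : Set X'), Ch X' σ S → Chain P (Y : Set P) X' σ S)
    (hY : (Y : Set P) ⊆ q ⁻¹' {IsLocalRing.closedPoint O}) (hYirr : IsIrreducible (Y : Set P)) (n : ℕ)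
    [SmoothOfRelativeDimension n q] :
    ∀ (X' : Scheme.{0}) (σ' : X' ⟶ P) (S' : Set X'), Ch X' σ' S' → IsLocallyNoetherian X' →
      Scheme.IsRegular X' → IsProper (σ' ≫ q) →
      ∀ (z : ↥(vanishingIdeal (⟨closure S', isClosed_closure⟩ : Closeds X')).subscheme),
        IsClosed ({((vanishingIdeal (⟨closure S', isClosed_closure⟩ : Closeds X')).subschemeι z : X')} : Set X') →
        ¬ IsRegularLocalRing ((vanishingIdeal (⟨closure S', isClosed_closure⟩ : Closeds X')).subscheme.presheaf.stalk z) →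
        Module.finrank (ResidueField ((vanishingIdeal (⟨closure S', isClosed_closure⟩ : Closeds X')).subscheme.presheaf.stalk z))
            (CotangentSpace ((vanishingIdeal (⟨closure S', isClosed_closure⟩ : Closeds X')).subscheme.presheaf.stalk z)) ≤ n →
        ∃ C : X'.IdealSheafData, Scheme.IsRegular C.subscheme ∧ Flat (C.subschemeι ≫ σ' ≫ q) ∧
          (C.support : Set X') ∩ (σ' ≫ q) ⁻¹' {IsLocalRing.closedPoint O} =
            {((vanishingIdeal (⟨closure S', isClosed_closure⟩ : Closeds X')).subschemeι z : X')} ∧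
          ∃ hzc : IsClosed ({z} : Set ↥(vanishingIdeal (⟨closure S', isClosed_closure⟩ : Closeds X')).subscheme),
            C.comap (vanishingIdeal (⟨closure S', isClosed_closure⟩ : Closeds X')).subschemeι = vanishingIdeal ⟨{z}, hzc⟩ :=
  hMS_of_multisection_finrank O P q Y Ch hChain (SmoothOfRelativeDimension.smooth n q) hY hYirr n
    (hdim_of_smoothOfRelativeDimension O P q Y Ch hChain hYirr n)

end Summit.ResolutionOfSingularities.ResolutionOfSingularities.Cruxes.EquisingularLiftNat.Sections
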